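import Summits.QuantumFields.YangMills.Theorems.LuscherReductionTwistedTraceScalingBTProductForm
import Summits.QuantumFields.YangMills.Theorems.LuscherReductionTwistedTraceScalingBTKineticSquares
import HarnessLib

/-!
# The CORE WEIGHT split of the Faddeev–Popov weight and the additivity of `fpBOKernel` in the weight
# (lane A of S-BASE, crux `TwistedTraceScaling` stmt-QuantumFields-20203, C4-CORE, the (B-T) pen; design note `pub/ym-fleet/ym-luscher-20007-p1/COARSE-DESIGN.md` §25.9)

* `coreSet R₁ = {g : every gauge jump ‖q(g_{x+k}) − q(g_x)‖ < R₁}` (open, measurable, invariant under global colour conjugation); `coreWeight ε R₁ = 𝟙_core·fpWeight ε`,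
  `tailWeight ε R₁ = 𝟙_{coreᶜ}·fpWeight ε`, `fpWeight = coreWeight + tailWeight`; both in `[0,1]`, measurable; `coreWeight_conj` (conjugation invariance);
* ★ `fpBOKernel_add_weight` — `fpBOKernel β Ω (W₁ + W₂) = fpBOKernel β Ω W₁ + fpBOKernel β Ω W₂` (bounded measurable data; `…BTProductForm.fpBOKernel_eq_integral_prod`);
  `fpBOKernel_fpWeight_split`; `fpBOKernel_nonneg`.
HONEST FRAMING: bookkeeping for a stub of a child of the CONDITIONAL reduction route R2b1; C4-CORE OPEN; not infinite volume, not a gap, not Clay.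
-/

set_option autoImplicit false

noncomputable section

open MeasureTheory Filter Topology Real
open scoped BigOperators Matrix Quaternion
open Literature.MathematicalPhysics.QuantumFieldTheory
open Literature.MathematicalPhysics.QuantumLattice

namespace Summit.QuantumFields.YangMills.Theorems.FemtoTransferGap.TwoLattice.ConstTube

open Summit.QuantumFields.YangMills.Theorems.FemtoTransferGap
open Summit.QuantumFields.YangMills.Theorems.FemtoTransferGap.TwoLattice
open Summit.QuantumFields.YangMills.Theorems.FemtoTransferGap.TwoLattice.Avg
open Summit.QuantumFields.YangMills.Theorems.FemtoTransferGap.TwoLattice.Stiff (LinkSpace)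

variable (L : ℕ) [NeZero L]

/-- **The gauge core**: every nearest-neighbour jump is `< R₁`. [folklore] -/
def coreSet (R₁ : ℝ) : Set (Site 3 L → SU2) := {g | ∀ e : Edge 3 L, ‖su2Quat (g (e.1.shift e.2)) - su2Quat (g e.1)‖ < R₁}

/-- **Core part of the Faddeev–Popov weight.** [folklore] -/
def coreWeight (ε R₁ : ℝ) : (Site 3 L → SU2) → ℝ := (coreSet L R₁).indicator (fpWeight L ε)

/-- **Tail part of the Faddeev–Popov weight.** [folklore] -/
def tailWeight (ε R₁ : ℝ) : (Site 3 L → SU2) → ℝ := (coreSet L R₁)ᶜ.indicator (fpWeight L ε)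

variable {L}

/-! ## §1 The core set -/

/-- The core is open. [folklore] -/
theorem isOpen_coreSet (R₁ : ℝ) : IsOpen (coreSet L R₁) := by
  have hq := @Literature.MathematicalPhysics.QuantumFieldTheory.Balaban1983to89.T4HaarSU2Translate.continuous_su2Quat
  have h : coreSet L R₁ = ⋂ e : Edge 3 L, {g : Site 3 L → SU2 | ‖su2Quat (g (e.1.shift e.2)) - su2Quat (g e.1)‖ < R₁} := by
    ext g; simp [coreSet]
  rw [h]
  have hc : ∀ x : Site 3 L, Continuous fun g : Site 3 L → SU2 => su2Quat (g x) := fun x => hq.comp (continuous_apply x)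
  exact isOpen_iInter_of_finite fun e => isOpen_lt (((hc (e.1.shift e.2)).sub (hc e.1)).norm) continuous_const

/-- The core is measurable. [folklore] -/
theorem measurableSet_coreSet (R₁ : ℝ) : MeasurableSet (coreSet L R₁) := by
  haveI : SecondCountableTopology SU2 := secondCountableTopology_su2
  exact (isOpen_coreSet (L := L) R₁).measurableSet

omit [NeZero L] in
/-- Global colour conjugation preserves gauge jumps. [folklore] -/
theorem norm_su2Quat_conj_sub_conj (c g h : SU2) : ‖su2Quat (c * g * c⁻¹) - su2Quat (c * h * c⁻¹)‖ = ‖su2Quat g - su2Quat h‖ := by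
  have hmul := @Literature.MathematicalPhysics.QuantumFieldTheory.Balaban1983to89.T4HaarSU2Translate.su2Quat_mul
  rw [hmul, hmul, hmul, hmul, ← sub_mul, ← mul_sub, norm_mul, norm_mul, norm_su2Quat, norm_su2Quat, one_mul, mul_one]

omit [NeZero L] in
/-- The core is invariant under global colour conjugation. [folklore] -/
theorem conj_mem_coreSet_iff (R₁ : ℝ) (c : SU2) (g : Site 3 L → SU2) : (fun x => c * g x * c⁻¹) ∈ coreSet L R₁ ↔ g ∈ coreSet L R₁ := by
  simp only [coreSet, Set.mem_setOf_eq, norm_su2Quat_conj_sub_conj]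

/-! ## §2 The two weights -/

/-- `fpWeight = coreWeight + tailWeight`. [folklore] -/
theorem fpWeight_eq_core_add_tail (ε R₁ : ℝ) : fpWeight L ε = coreWeight L ε R₁ + tailWeight L ε R₁ := by
  funext g; unfold coreWeight tailWeight; simp only [Pi.add_apply, Set.indicator_compl, Pi.sub_apply]; ring

/-- The core weight is measurable. [folklore] -/
theorem measurable_coreWeight (ε R₁ : ℝ) : Measurable (coreWeight L ε R₁) := (measurable_fpWeight L ε).indicator (measurableSet_coreSet R₁)

/-- The tail weight is measurable. [folklore] -/
theorem measurable_tailWeight (ε R₁ : ℝ) : Measurable (tailWeight L ε R₁) := (measurable_fpWeight L ε).indicator (measurableSet_coreSet R₁).compl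

/-- `0 ≤ coreWeight ≤ 1`. [folklore] -/
theorem coreWeight_mem_Icc (ε R₁ : ℝ) (g : Site 3 L → SU2) : 0 ≤ coreWeight L ε R₁ g ∧ coreWeight L ε R₁ g ≤ 1 := by
  unfold coreWeight
  by_cases hg : g ∈ coreSet L R₁
  · rw [Set.indicator_of_mem hg]; exact fpWeight_mem_Icc L ε g
  · rw [Set.indicator_of_notMem hg]; exact ⟨le_rfl, zero_le_one⟩

/-- `0 ≤ tailWeight ≤ 1`. [folklore] -/
theorem tailWeight_mem_Icc (ε R₁ : ℝ) (g : Site 3 L → SU2) : 0 ≤ tailWeight L ε R₁ g ∧ tailWeight L ε R₁ g ≤ 1 := by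
  unfold tailWeight
  by_cases hg : g ∈ (coreSet L R₁)ᶜ
  · rw [Set.indicator_of_mem hg]; exact fpWeight_mem_Icc L ε g
  · rw [Set.indicator_of_notMem hg]; exact ⟨le_rfl, zero_le_one⟩

/-- `|coreWeight| ≤ 1`. [folklore] -/
theorem abs_coreWeight_le (ε R₁ : ℝ) (g : Site 3 L → SU2) : |coreWeight L ε R₁ g| ≤ 1 := by
  have h := coreWeight_mem_Icc (L := L) ε R₁ g; rw [abs_of_nonneg h.1]; exact h.2

/-- `|tailWeight| ≤ 1`. [folklore] -/
theorem abs_tailWeight_le (ε R₁ : ℝ) (g : Site 3 L → SU2) : |tailWeight L ε R₁ g| ≤ 1 := by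
  have h := tailWeight_mem_Icc (L := L) ε R₁ g; rw [abs_of_nonneg h.1]; exact h.2

/-- ★ The core weight is invariant under global colour conjugation. [folklore] -/
theorem coreWeight_conj (ε R₁ : ℝ) (c : SU2) (g : Site 3 L → SU2) : coreWeight L ε R₁ (fun x => c * g x * c⁻¹) = coreWeight L ε R₁ g := by
  unfold coreWeight
  by_cases hg : g ∈ coreSet L R₁
  · rw [Set.indicator_of_mem hg, Set.indicator_of_mem ((conj_mem_coreSet_iff R₁ c g).mpr hg), fpWeight_conj]
  · rw [Set.indicator_of_notMem hg, Set.indicator_of_notMem (fun h => hg ((conj_mem_coreSet_iff R₁ c g).mp h))]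

/-- The core weight is supported in the slab AND the core. [folklore] -/
theorem mem_of_coreWeight_ne_zero {ε R₁ : ℝ} {g : Site 3 L → SU2} (hg : coreWeight L ε R₁ g ≠ 0) : g ∈ coreSet L R₁ ∧ colourMean L g ∈ fpBall ε := by
  unfold coreWeight at hg
  by_cases h : g ∈ coreSet L R₁
  · rw [Set.indicator_of_mem h] at hg
    refine ⟨h, ?_⟩
    by_contra hm; apply hg; unfold fpWeight; rw [Set.indicator_of_notMem hm]
  · exact absurd (Set.indicator_of_notMem h (fpWeight L ε)) hg

/-- The tail weight is supported in the slab OFF the core. [folklore] -/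
theorem mem_of_tailWeight_ne_zero {ε R₁ : ℝ} {g : Site 3 L → SU2} (hg : tailWeight L ε R₁ g ≠ 0) : g ∉ coreSet L R₁ ∧ colourMean L g ∈ fpBall ε := by
  unfold tailWeight at hg
  by_cases h : g ∈ (coreSet L R₁)ᶜ
  · rw [Set.indicator_of_mem h] at hg
    refine ⟨h, ?_⟩
    by_contra hm; apply hg; unfold fpWeight; rw [Set.indicator_of_notMem hm]
  · exact absurd (Set.indicator_of_notMem h (fpWeight L ε)) hg

/-- The Faddeev–Popov weight is supported in the slab. [folklore] -/
theorem mem_fpBall_of_fpWeight_ne_zero {ε : ℝ} {g : Site 3 L → SU2} (hg : fpWeight L ε g ≠ 0) : colourMean L g ∈ fpBall ε := by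
  by_contra hm; apply hg; unfold fpWeight; rw [Set.indicator_of_notMem hm]

omit [NeZero L] in
/-- Off the core some jump is `≥ R₁`. [folklore] -/
theorem exists_jump_ge_of_not_mem_coreSet {R₁ : ℝ} {g : Site 3 L → SU2} (hg : g ∉ coreSet L R₁) :
    ∃ e : Edge 3 L, R₁ ≤ ‖su2Quat (g (e.1.shift e.2)) - su2Quat (g e.1)‖ := by
  simp only [coreSet, Set.mem_setOf_eq, not_forall, not_lt] at hg
  exact hg

omit [NeZero L] in
/-- The quaternion core `G_c(ρ)` (all `‖q(g_x) − 1‖ ≤ ρ`) lies in `coreSet R₁` once `2ρ < R₁`. [folklore] -/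
theorem mem_coreSet_of_forall_norm_sub_one_le {ρ R₁ : ℝ} (hρ : 2 * ρ < R₁) {g : Site 3 L → SU2} (hg : ∀ x, ‖su2Quat (g x) - 1‖ ≤ ρ) : g ∈ coreSet L R₁ := by
  intro e
  have h := norm_sub_le_norm_sub_add_norm_sub (su2Quat (g (e.1.shift e.2))) 1 (su2Quat (g e.1))
  rw [norm_sub_rev (1 : ℍ)] at h
  linarith [hg e.1, hg (e.1.shift e.2)]

/-! ## §3 ★ Additivity of `fpBOKernel` in the weight -/

/-- ★ **`fpBOKernel` is additive in the weight** (bounded measurable data). [folklore] -/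
theorem fpBOKernel_add_weight (β : ℝ) {Ω : LinkSpace L → ℝ} (hΩm : Measurable Ω) {CΩ : ℝ} (hCΩ : ∀ x, |Ω x| ≤ CΩ)
    {W₁ W₂ : (Site 3 L → SU2) → ℝ} (hW₁ : Measurable W₁) (hW₂ : Measurable W₂) {C₁ C₂ : ℝ} (hC₁ : ∀ g, |W₁ g| ≤ C₁) (hC₂ : ∀ g, |W₂ g| ≤ C₂) (u u' : GaugeConfig 3 1 SU2) :
    fpBOKernel L β Ω (W₁ + W₂) u u' = fpBOKernel L β Ω W₁ u u' + fpBOKernel L β Ω W₂ u u' := by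
  haveI := isFiniteMeasure_orthoTransverse L
  have hC12 : ∀ g, |(W₁ + W₂) g| ≤ C₁ + C₂ := fun g => by rw [Pi.add_apply]; exact (abs_add_le _ _).trans (add_le_add (hC₁ g) (hC₂ g))
  rw [fpBOKernel_eq_integral_prod β hΩm hCΩ (hW₁.add hW₂) hC12, fpBOKernel_eq_integral_prod β hΩm hCΩ hW₁ hC₁, fpBOKernel_eq_integral_prod β hΩm hCΩ hW₂ hC₂]
  obtain ⟨B₁, hB₁⟩ := abs_fpTriple_le (L := L) β hCΩ hC₁ u u'
  obtain ⟨B₂, hB₂⟩ := abs_fpTriple_le (L := L) β hCΩ hC₂ u u'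
  rw [← integral_add (integrable_of_measurable_abs_le _ (measurable_fpTriple β hΩm hW₁ u u') hB₁) (integrable_of_measurable_abs_le _ (measurable_fpTriple β hΩm hW₂ u u') hB₂)]
  refine integral_congr_ae (ae_of_all _ fun p => ?_)
  simp only [fpTriple, Pi.add_apply]
  ring

/-- The Faddeev–Popov BO kernel splits into core and tail. [folklore] -/
theorem fpBOKernel_fpWeight_split (β ε R₁ : ℝ) {Ω : LinkSpace L → ℝ} (hΩm : Measurable Ω) {CΩ : ℝ} (hCΩ : ∀ x, |Ω x| ≤ CΩ) (u u' : GaugeConfig 3 1 SU2) :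
    fpBOKernel L β Ω (fpWeight L ε) u u' = fpBOKernel L β Ω (coreWeight L ε R₁) u u' + fpBOKernel L β Ω (tailWeight L ε R₁) u u' := by
  rw [fpWeight_eq_core_add_tail (L := L) ε R₁]
  exact fpBOKernel_add_weight β hΩm hCΩ (measurable_coreWeight ε R₁) (measurable_tailWeight ε R₁) (abs_coreWeight_le ε R₁) (abs_tailWeight_le ε R₁) u u'

/-- `fpBOKernel ≥ 0` for nonnegative data. [folklore] -/
theorem fpBOKernel_nonneg (β : ℝ) {Ω : LinkSpace L → ℝ} (hΩm : Measurable Ω) {CΩ : ℝ} (hCΩ : ∀ x, |Ω x| ≤ CΩ) (hΩ0 : ∀ x, 0 ≤ Ω x)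
    {W : (Site 3 L → SU2) → ℝ} (hW : Measurable W) {CW : ℝ} (hCW : ∀ g, |W g| ≤ CW) (hW0 : ∀ g, 0 ≤ W g) (u u' : GaugeConfig 3 1 SU2) :
    0 ≤ fpBOKernel L β Ω W u u' := by
  rw [fpBOKernel_eq_integral_prod β hΩm hCΩ hW hCW]
  refine integral_nonneg fun p => ?_
  unfold fpTriple
  exact mul_nonneg (hΩ0 _) (mul_nonneg (mul_nonneg (hW0 _) (transferKernel_pos _ _ _ _).le) (hΩ0 _))

end Summit.QuantumFields.YangMills.Theorems.FemtoTransferGap.TwoLattice.ConstTube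

end
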